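import Summits.NavierStokesRegularity.NavierStokesRegularity.Theorems.OddMorawetzDefs
import Literature.Analysis.FluidPDE.TaoAveragedEulerProofs

/-!
# Route OddMorawetz / `OrderThreeIndefinite` — calculus of polynomial-Gaussian fields

Support file for item stmt-NavierStokesRegularity-1379 (`OrderThreeIndefinite`, route `OddMorawetz`): the calculus of
the polynomial × Gaussian vocabulary of `OddMorawetzDefs` — derivatives of `pev p`, `pg k p`, `pgv k P` in coordinates
(`fderiv_pg_apply`: `∂ⱼ(p e^{-k r²}) = (dg k j p) e^{-k r²}`), curl and divergence of `pgv k P` as polynomial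
Gaussian fields (`curl_pgv`, `divergence_pgv`, against the tree's `Literature.Analysis.FluidPDE.curl` /
`VectorCalculus.divergence`), the values of the Schwartz packagings `pgS`, `pgvS`, `pgC` (hence
`isSchwartzField_pgv`), line derivatives `∂_{eⱼ} (pgC k p) = pgC k (dg k j p)` and the Fourier transform of iterated
line derivatives, `𝓕(∂^l f)(ξ) = (∏_{j∈l} 2πi ξⱼ) 𝓕 f(ξ)` (Mathlib `SchwartzMap.fourier_lineDerivOp_eq`).
Everything is proved; no definitions.
-/

noncomputable section

open MeasureTheory SchwartzMap MvPolynomial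
open scoped RealInnerProductSpace LineDeriv

-- the problem namespace `Summit.NavierStokesRegularity.NavierStokesRegularity` repeats the summit name by design (D-0017)
set_option linter.dupNamespace false

namespace Summit.NavierStokesRegularity.NavierStokesRegularity.Theorems.OddMorawetz

/-! ### pg algebra -/
/-- Unfolding `pg`. -/
theorem pg_def (k : ℕ) (p : P3) (x : E3) : pg k p x = pev p x * Real.exp (-(k : ℝ) * ‖x‖ ^ 2) := rfl
/-- Products of polynomial Gaussians: rates and polynomials multiply. -/
theorem pg_mul (a b : ℕ) (p q : P3) (x : E3) : pg a p x * pg b q x = pg (a + b) (p * q) x := by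
  simp only [pg, pev_mul, Nat.cast_add]
  rw [show -((a : ℝ) + b) * ‖x‖ ^ 2 = -(a : ℝ) * ‖x‖ ^ 2 + -(b : ℝ) * ‖x‖ ^ 2 by ring, Real.exp_add]
  ring
/-- `pg` is additive in the polynomial. -/
theorem pg_add (k : ℕ) (p q : P3) (x : E3) : pg k (p + q) x = pg k p x + pg k q x := by
  simp only [pg, pev_add]; ring
/-- `pg` respects subtraction of polynomials. -/
theorem pg_sub (k : ℕ) (p q : P3) (x : E3) : pg k (p - q) x = pg k p x - pg k q x := by
  simp only [pg, pev_sub]; ring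
/-- `pg` respects negation of polynomials. -/
theorem pg_neg (k : ℕ) (p : P3) (x : E3) : pg k (-p) x = -pg k p x := by
  simp only [pg, pev_neg]; ring
/-- `pg` respects real scalar multiples. -/
theorem pg_smul (k : ℕ) (c : ℝ) (p : P3) (x : E3) : pg k (c • p) x = c * pg k p x := by
  simp only [pg, pev_smul]; ring
/-- `pg k 0 = 0`. -/
@[simp] theorem pg_zero (k : ℕ) (x : E3) : pg k 0 x = 0 := by simp [pg]
/-- `pg` respects finite sums of polynomials. -/
theorem pg_sum {ι : Type*} (s : Finset ι) (k : ℕ) (p : ι → P3) (x : E3) :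
    pg k (∑ i ∈ s, p i) x = ∑ i ∈ s, pg k (p i) x := by
  simp only [pg, pev, map_sum, Finset.sum_mul]

/-! ### derivatives -/

/-- Coordinates are differentiable with derivative the coordinate projection. -/
theorem hasFDerivAt_coord (i : Fin 3) (x : E3) :
    HasFDerivAt (fun y : E3 => y i) (EuclideanSpace.proj (𝕜 := ℝ) i) x :=
  (EuclideanSpace.proj (𝕜 := ℝ) i).hasFDerivAt
/-- The value of the derivative `Dpev p x` on a vector. -/
theorem Dpev_apply (p : P3) (x w : E3) : Dpev p x w = ∑ j : Fin 3, pev (pderiv j p) x * w j := by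
  simp [Dpev]

/-- **Polynomials are differentiable** with derivative `Dpev` (induction on the polynomial). -/
theorem hasFDerivAt_pev (p : P3) (x : E3) : HasFDerivAt (pev p) (Dpev p x) x := by
  induction p using MvPolynomial.induction_on with
  | C a =>
    have h0 : Dpev (C a) x = 0 := by ext w; simp [Dpev_apply]
    rw [h0]
    exact (hasFDerivAt_const a x).congr_of_eventuallyEq
      (Filter.Eventually.of_forall fun y => pev_C a y)
  | add p q hp hq =>
    have h' : HasFDerivAt (pev (p + q)) (Dpev p x + Dpev q x) x :=
      (hp.add hq).congr_of_eventuallyEq (Filter.Eventually.of_forall fun y => pev_add p q y)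
    refine h'.congr_fderiv ?_
    ext w
    simp only [add_apply, Dpev_apply, map_add, pev_add, ← Finset.sum_add_distrib]
    exact Finset.sum_congr rfl fun j _ => by ring
  | mul_X p n hp =>
    have h' : HasFDerivAt (pev (p * X n))
        (pev p x • EuclideanSpace.proj (𝕜 := ℝ) n + x n • Dpev p x) x :=
      (hp.mul (hasFDerivAt_coord n x)).congr_of_eventuallyEq
        (Filter.Eventually.of_forall fun y => by simp)
    refine h'.congr_fderiv ?_
    ext w
    simp only [add_apply, FunLike.coe_smul, Pi.smul_apply, Dpev_apply,
      smul_eq_mul, Derivation.leibniz, pderiv_X, pev_add]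
    fin_cases n <;> simp [Fin.sum_univ_three, Pi.single_apply, pev] <;> ring

/-- The derivative of the Gaussian `e^{-k|x|²}`. -/
theorem hasFDerivAt_gauss (k : ℝ) (x : E3) :
    HasFDerivAt (fun y : E3 => Real.exp (-k * ‖y‖ ^ 2))
      ((-k * Real.exp (-k * ‖x‖ ^ 2)) • (2 • innerSL ℝ x)) x := by
  have h1 : HasFDerivAt (fun y : E3 => ‖y‖ ^ 2) (2 • innerSL ℝ x) x := (hasStrictFDerivAt_norm_sq x).hasFDerivAt
  have h2 : HasFDerivAt (fun y : E3 => -k * ‖y‖ ^ 2) ((-k) • (2 • innerSL ℝ x)) x := h1.const_mul (-k)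
  have h3 := h2.exp
  refine h3.congr_fderiv ?_
  rw [smul_smul, mul_comm]

/-- **The derivative of a polynomial Gaussian**: `D(p e^{-k r²})(x)[w] = ∑ⱼ wⱼ (dg k j p)(x) e^{-k r²}`. -/
theorem hasFDerivAt_pg (k : ℕ) (p : P3) (x : E3) :
    HasFDerivAt (pg k p) (Real.exp (-(k : ℝ) * ‖x‖ ^ 2) • Dpev p x +
      (pev p x * (-(k : ℝ) * Real.exp (-(k : ℝ) * ‖x‖ ^ 2))) • (2 • innerSL ℝ x)) x := by
  have h := (hasFDerivAt_pev p x).mul (hasFDerivAt_gauss (k : ℝ) x)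
  refine h.congr_fderiv ?_
  rw [smul_smul, add_comm]

/-- **The derivative of a polynomial Gaussian in coordinates**: `D(p e^{-k r²})(x)[w] = ∑ⱼ wⱼ (dg k j p)(x) e^{-k r²}`. -/
theorem fderiv_pg_apply (k : ℕ) (p : P3) (x w : E3) :
    fderiv ℝ (pg k p) x w = ∑ j : Fin 3, w j * pg k (dg k j p) x := by
  rw [(hasFDerivAt_pg k p x).fderiv]
  simp only [add_apply, FunLike.coe_smul, Pi.smul_apply, Dpev_apply,
    smul_eq_mul, innerSL_apply_apply, PiLp.inner_apply, RCLike.inner_apply, conj_trivial, dg, pg, pev_sub, pev_mul, pev_X, pev_ofNat, pev_natCast, Finset.mul_sum, Finset.smul_sum]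
  rw [← Finset.sum_add_distrib]
  exact Finset.sum_congr rfl fun j _ => by ring

/-- Polynomial Gaussians are differentiable. -/
theorem differentiable_pg (k : ℕ) (p : P3) : Differentiable ℝ (pg k p) := fun x =>
  (hasFDerivAt_pg k p x).differentiableAt

/-! ### vector fields -/

/-- Coordinates of the vector field `pgv k P`. -/
theorem pgv_apply (k : ℕ) (P : Fin 3 → P3) (x : E3) (i : Fin 3) : pgv k P x i = pg k (P i) x := by
  simp [pgv, Pi.single_apply]

/-- The vector field `pgv k P` is differentiable. -/
theorem hasFDerivAt_pgv (k : ℕ) (P : Fin 3 → P3) (x : E3) :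
    HasFDerivAt (pgv k P) (∑ i, (fderiv ℝ (pg k (P i)) x).smulRight (EuclideanSpace.single i (1 : ℝ))) x := by
  unfold pgv
  exact HasFDerivAt.fun_sum fun i _ => ((hasFDerivAt_pg k (P i) x).differentiableAt.hasFDerivAt).smul_const _

/-- Coordinates of the derivative of `pgv k P`. -/
theorem fderiv_pgv_apply (k : ℕ) (P : Fin 3 → P3) (x w : E3) (i : Fin 3) :
    fderiv ℝ (pgv k P) x w i = ∑ j : Fin 3, w j * pg k (dg k j (P i)) x := by
  rw [(hasFDerivAt_pgv k P x).fderiv, ← fderiv_pg_apply]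
  simp [Pi.single_apply]

/-- `pgv k P` is differentiable. -/
theorem differentiable_pgv (k : ℕ) (P : Fin 3 → P3) : Differentiable ℝ (pgv k P) := fun x =>
  (hasFDerivAt_pgv k P x).differentiableAt

/-- Partial derivatives of `pgv k P` in coordinates: `∂ⱼ vᵢ = (dg k j (P i)) e^{-k r²}`. -/
theorem fderiv_pgv_single (k : ℕ) (P : Fin 3 → P3) (x : E3) (j i : Fin 3) :
    fderiv ℝ (pgv k P) x (EuclideanSpace.single j (1 : ℝ)) i = pg k (dg k j (P i)) x := by
  rw [fderiv_pgv_apply]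
  simp [PiLp.single_apply]

/-- **curl of a polynomial Gaussian field**. -/
theorem curl_pgv (k : ℕ) (P : Fin 3 → P3) (x : E3) :
    Literature.Analysis.FluidPDE.curl (pgv k P) x = pgv k (curlP k P) x := by
  ext i
  rw [pgv_apply]
  simp only [Literature.Analysis.FluidPDE.curl, fderiv_pgv_single]
  fin_cases i <;> simp [curlP, pg_sub]

/-- **divergence of a polynomial Gaussian field**. -/
theorem divergence_pgv (k : ℕ) (P : Fin 3 → P3) (x : E3) :
    Literature.Analysis.FluidPDE.VectorCalculus.divergence (pgv k P) x = ∑ i : Fin 3, pg k (dg k i (P i)) x := by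
  rw [Literature.Analysis.FluidPDE.divergence_eq_sum_fderiv_apply]
  refine Finset.sum_congr rfl fun i _ => ?_
  rw [show EuclideanSpace.basisFun (Fin 3) ℝ i = EuclideanSpace.single i (1 : ℝ) from by simp,
    fderiv_pgv_single]


/-! ### Schwartz packaging -/

/-- Values of the Schwartz function `pgS k p` (`0 < k`). -/
@[simp] theorem pgS_apply (k : ℕ) (hk : 0 < k) (p : P3) (x : E3) : pgS k p x = pg k p x := by
  have hk' : (0 : ℝ) < k := by exact_mod_cast hk
  rw [pgS, SchwartzMap.bilinLeftCLM_apply]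
  simp only []
  rw [Literature.Analysis.FunctionSpaces.realGaussianSchwartz_apply hk', ContinuousLinearMap.mul_apply', pg]
  ring

/-- The Schwartz function `pgS k p` as a function (`0 < k`). -/
theorem coe_pgS (k : ℕ) (hk : 0 < k) (p : P3) : ⇑(pgS k p) = pg k p := funext (pgS_apply k hk p)

/-- Values of the Schwartz field `pgvS k P` (`0 < k`). -/
@[simp] theorem pgvS_apply (k : ℕ) (hk : 0 < k) (P : Fin 3 → P3) (x : E3) : pgvS k P x = pgv k P x := by
  simp only [pgvS, pgv]
  rw [show (∑ i, SchwartzMap.postcompCLM (𝕜 := ℝ)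
      (ContinuousLinearMap.toSpanSingleton ℝ (EuclideanSpace.single i (1 : ℝ))) (pgS k (P i))) x =
      ∑ i, (SchwartzMap.postcompCLM (𝕜 := ℝ)
        (ContinuousLinearMap.toSpanSingleton ℝ (EuclideanSpace.single i (1 : ℝ))) (pgS k (P i))) x from
    by simp]
  refine Finset.sum_congr rfl fun i _ => ?_
  rw [SchwartzMap.postcompCLM_apply, pgS_apply k hk, ContinuousLinearMap.toSpanSingleton_apply]

/-- The Schwartz field `pgvS k P` as a function (`0 < k`). -/
theorem coe_pgvS (k : ℕ) (hk : 0 < k) (P : Fin 3 → P3) : ⇑(pgvS k P) = pgv k P :=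
  funext (pgvS_apply k hk P)

/-- **Polynomial Gaussian fields are Schwartz fields** (`0 < k`). -/
theorem isSchwartzField_pgv (k : ℕ) (hk : 0 < k) (P : Fin 3 → P3) :
    Literature.Analysis.FluidPDE.IsSchwartzField (pgv k P) :=
  ⟨pgvS k P, coe_pgvS k hk P⟩

/-- Polynomial Gaussians are integrable (`0 < k`). -/
theorem integrable_pg (k : ℕ) (hk : 0 < k) (p : P3) : Integrable (pg k p) := by
  rw [← coe_pgS k hk p]; exact (pgS k p).integrable
/-! ### complex-valued versions and iterated line derivatives (Fourier side) -/

/-- Values of the complex Schwartz function `pgC k p` (`0 < k`). -/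
@[simp] theorem pgC_apply (k : ℕ) (hk : 0 < k) (p : P3) (x : E3) : pgC k p x = (pg k p x : ℂ) := by
  rw [pgC, SchwartzMap.postcompCLM_apply, pgS_apply k hk]; rfl

/-- line derivative of `pgC` along `e_j`. -/
theorem lineDerivOp_pgC (k : ℕ) (hk : 0 < k) (p : P3) (j : Fin 3) :
    (∂_{EuclideanSpace.single j (1 : ℝ)} (pgC k p) : 𝓢(E3, ℂ)) = pgC k (dg k j p) := by
  ext x
  rw [SchwartzMap.lineDerivOp_apply_eq_fderiv, pgC_apply k hk]
  have hc : ⇑(pgC k p) = fun y => ((pg k p y : ℝ) : ℂ) := funext (pgC_apply k hk p)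
  rw [hc]
  have h := (Complex.ofRealCLM.hasFDerivAt.comp x (hasFDerivAt_pg k p x).differentiableAt.hasFDerivAt)
  rw [show (fun y => ((pg k p y : ℝ) : ℂ)) = ⇑Complex.ofRealCLM ∘ pg k p from rfl, h.fderiv,
    ContinuousLinearMap.comp_apply, fderiv_pg_apply]
  simp [PiLp.single_apply]

/-- `iterLD [] f = f`. -/
@[simp] theorem iterLD_nil (f : 𝓢(E3, ℂ)) : iterLD [] f = f := rfl
/-- `iterLD (j :: l) f = ∂ⱼ (iterLD l f)`. -/
@[simp] theorem iterLD_cons (j : Fin 3) (l : List (Fin 3)) (f : 𝓢(E3, ℂ)) :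
    iterLD (j :: l) f = ∂_{EuclideanSpace.single j (1 : ℝ)} (iterLD l f) := rfl
/-- `dgList k [] p = p`. -/
@[simp] theorem dgList_nil (k : ℕ) (p : P3) : dgList k [] p = p := rfl
/-- `dgList k (j :: l) p = dg k j (dgList k l p)`. -/
@[simp] theorem dgList_cons (k : ℕ) (j : Fin 3) (l : List (Fin 3)) (p : P3) :
    dgList k (j :: l) p = dg k j (dgList k l p) := rfl

/-- Iterated line derivatives of `pgC k p` are `pgC k (dgList k l p)`. -/
theorem iterLD_pgC (k : ℕ) (hk : 0 < k) (p : P3) (l : List (Fin 3)) :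
    iterLD l (pgC k p) = pgC k (dgList k l p) := by
  induction l with
  | nil => rfl
  | cons j l ih => rw [iterLD_cons, ih, lineDerivOp_pgC k hk, dgList_cons]

open FourierTransform in
/-- **Fourier transform of iterated derivatives**: `𝓕(∂^l f)(ξ) = (∏_{j∈l} 2πi ξⱼ) 𝓕f(ξ)`. -/
theorem fourier_iterLD_apply (l : List (Fin 3)) (f : 𝓢(E3, ℂ)) (ξ : E3) :
    (𝓕 (iterLD l f) : 𝓢(E3, ℂ)) ξ = (l.map fun j => 2 * Real.pi * Complex.I * (ξ j : ℂ)).prod * (𝓕 f : 𝓢(E3, ℂ)) ξ := by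
  induction l with
  | nil => simp
  | cons j l ih =>
    have hg : (fun x : E3 => ⟪x, EuclideanSpace.single j (1 : ℝ)⟫).HasTemperateGrowth :=
      Function.hasTemperateGrowth_inner_left _
    rw [iterLD_cons, SchwartzMap.fourier_lineDerivOp_eq, smul_apply,
      SchwartzMap.smulLeftCLM_apply_apply hg, ih]
    simp only [EuclideanSpace.inner_single_right, List.map_cons, List.prod_cons, one_mul,
      Complex.real_smul, smul_eq_mul, conj_trivial]
    ring


end Summit.NavierStokesRegularity.NavierStokesRegularity.Theorems.OddMorawetz
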